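import Mathlib
import Literature.Analysis.OperatorTheory.L2KernelIntegralOperator
import Literature.Analysis.OperatorTheory.SupNormCompactOperator
import Summits.RiemannHypothesis.RiemannHypothesis.Theorems.SuzukiWindowsDoorTempleWindow
import HarnessLib

/-!
# SuzukiWindowsDoorKernelMonotone — operator-norm comparison `|K₁| ≤ K₂ ⇒ ‖A₁‖ ≤ ‖A₂‖` for `L²` integral operators, and `‖A_{θ+1}‖ ≤ 2‖A_θ‖` for the onset kernels `(x+y)₊^{θ−1}` on `L²(−1,1)` (column DBR; RH-FREE)

RH-FREE operator theory; nothing here bears on the truth of RH.  Tree style of `SuzukiWindowsDoorTempleWindow` /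
`Literature.Analysis.OperatorTheory.L2KernelIntegralOperator`: an integral operator is ANY bounded `A` on
`Lp ℝ 2 μ` with the a.e. kernel formula `(Aφ)(x) = ∫ K(x,y)φ(y) dμ(y)` — no definition is introduced.

* §1 `opNorm_le_of_abs_kernel_le` — for an `L²(μ⊗μ)` kernel `K₂` and any kernel `K₁` with `|K₁| ≤ K₂` a.e.,
  `‖A₁‖ ≤ ‖A₂‖` (`|∫K₁φ| ≤ ∫K₂|φ|` row-wise, `‖|φ|‖ = ‖φ‖` in the Banach lattice `L²`);
* §2 the window (Hankel) form on `L²(−t,t)` for continuous `K₂` with `|K₁(u)| ≤ K₂(u)`, and the DBR instance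
  `opNorm_onsetOp_succ_le_two_mul`: for `θ > 1` and the onset kernels `(x+y)₊^θ`, `(x+y)₊^{θ−1}` on `(−1,1)²`,
  `‖A_{θ+1}‖ ≤ 2‖A_θ‖` (`(x+y)₊ ≤ 2`) — the RH-FREE support `windowOp_succ_le_two_mul` of the small-`t` law of the
  window norms `σ₁(θ,t) = c_θ‖A_θ‖t^θ(1 + κ_θ t + …)` (rh-dbr TARGET-v8 §L.4 (ii); DATA §ET1f-lite certified
  `‖A_θ‖`, `θ = 2…7`).  The small-`t` law itself is a numerical model and is NOT claimed here.
-/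

set_option linter.dupNamespace false

noncomputable section

open MeasureTheory Set Function Filter
open scoped ENNReal

namespace Summit.RiemannHypothesis.RiemannHypothesis.Theorems.SuzukiWindowsDoorKernelMonotone

open Literature.Analysis.OperatorTheory
open Summit.RiemannHypothesis.RiemannHypothesis.Theorems.SuzukiWindowsDoorTempleGalerkin

/-! ## §1 Comparison of operator norms for kernels `|K₁| ≤ K₂` -/

section General

variable {X : Type*} [MeasurableSpace X] {μ : Measure X} [SFinite μ]

/-- **Operator-norm comparison** (RH-free, general measure space): if `K₂ ∈ L²(μ⊗μ)`, `|K₁(x,y)| ≤ K₂(x,y)`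
for a.e. `x` and a.e. `y`, and `A₁`, `A₂` are bounded operators on `L²(μ)` with the kernel formulas for `K₁`,
`K₂`, then `‖A₁‖ ≤ ‖A₂‖`.  (Row-wise `|∫ K₁(x,y)φ(y)| ≤ ∫ K₂(x,y)|φ(y)|`, so `‖A₁φ‖ ≤ ‖A₂|φ|‖ ≤ ‖A₂‖‖φ‖`,
using `‖|φ|‖ = ‖φ‖` in the Banach lattice `L²(μ)`.) -/
theorem opNorm_le_of_abs_kernel_le {K₁ K₂ : X → X → ℝ} (hK₂ : MemLp (uncurry K₂) 2 (μ.prod μ))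
    (hle : ∀ᵐ x ∂μ, ∀ᵐ y ∂μ, |K₁ x y| ≤ K₂ x y)
    {A₁ A₂ : Lp ℝ 2 μ →L[ℝ] Lp ℝ 2 μ}
    (hA₁ : ∀ φ : Lp ℝ 2 μ, (A₁ φ : X → ℝ) =ᵐ[μ] fun x => ∫ y, K₁ x y * φ y ∂μ)
    (hA₂ : ∀ φ : Lp ℝ 2 μ, (A₂ φ : X → ℝ) =ᵐ[μ] fun x => ∫ y, K₂ x y * φ y ∂μ) :
    ‖A₁‖ ≤ ‖A₂‖ := by
  refine ContinuousLinearMap.opNorm_le_bound _ (norm_nonneg _) fun φ => ?_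
  set ψ : Lp ℝ 2 μ := |φ| with hψ
  have hψn : ‖ψ‖ = ‖φ‖ := norm_abs_eq_norm φ
  have hψae : (ψ : X → ℝ) =ᵐ[μ] fun x => |φ x| := Lp.coeFn_abs φ
  -- row-wise comparison
  have hpt : ∀ᵐ x ∂μ, |∫ y, K₁ x y * φ y ∂μ| ≤ ∫ y, K₂ x y * ψ y ∂μ := by
    filter_upwards [ae_memLp_l2Kernel_section hK₂, hle] with x hx hxy
    have hint : Integrable (fun y => K₂ x y * ψ y) μ := hx.integrable_mul (Lp.memLp ψ)
    have hmaj : ∀ᵐ y ∂μ, ‖K₁ x y * φ y‖ ≤ K₂ x y * ψ y := by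
      filter_upwards [hψae, hxy] with y hy hKy
      rw [hy, Real.norm_eq_abs, abs_mul]
      exact mul_le_mul_of_nonneg_right hKy (abs_nonneg _)
    have h := norm_integral_le_of_norm_le hint hmaj
    rwa [Real.norm_eq_abs] at h
  -- squared norms as integrals
  have h1 : ‖A₁ φ‖ ^ 2 = ∫ x, (∫ y, K₁ x y * φ y ∂μ) ^ 2 ∂μ := by
    rw [norm_sq_eq_integral_norm_sq (𝕜 := ℝ)]
    refine integral_congr_ae ?_
    filter_upwards [hA₁ φ] with x hx
    rw [hx, Real.norm_eq_abs, sq_abs]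
  have h2 : ‖A₂ ψ‖ ^ 2 = ∫ x, (∫ y, K₂ x y * ψ y ∂μ) ^ 2 ∂μ := by
    rw [norm_sq_eq_integral_norm_sq (𝕜 := ℝ)]
    refine integral_congr_ae ?_
    filter_upwards [hA₂ ψ] with x hx
    rw [hx, Real.norm_eq_abs, sq_abs]
  have hint2 : Integrable (fun x => (∫ y, K₂ x y * ψ y ∂μ) ^ 2) μ := by
    have h := (Lp.memLp (A₂ ψ)).integrable_sq
    exact h.congr (by filter_upwards [hA₂ ψ] with x hx; rw [hx])
  have hsq : ‖A₁ φ‖ ^ 2 ≤ ‖A₂ ψ‖ ^ 2 := by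
    rw [h1, h2]
    refine integral_mono_of_nonneg (Eventually.of_forall fun x => sq_nonneg _) hint2 ?_
    filter_upwards [hpt] with x hx
    have h0 : 0 ≤ ∫ y, K₂ x y * ψ y ∂μ := (abs_nonneg _).trans hx
    calc (∫ y, K₁ x y * φ y ∂μ) ^ 2 = |∫ y, K₁ x y * φ y ∂μ| ^ 2 := (sq_abs _).symm
      _ ≤ (∫ y, K₂ x y * ψ y ∂μ) ^ 2 := pow_le_pow_left₀ (abs_nonneg _) hx 2
  have hle' : ‖A₁ φ‖ ≤ ‖A₂ ψ‖ := (pow_le_pow_iff_left₀ (norm_nonneg _) (norm_nonneg _) two_ne_zero).mp hsq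
  calc ‖A₁ φ‖ ≤ ‖A₂ ψ‖ := hle'
    _ ≤ ‖A₂‖ * ‖ψ‖ := A₂.le_opNorm ψ
    _ = ‖A₂‖ * ‖φ‖ := by rw [hψn]

end General

/-! ## §2 Window (Hankel) operators on `L²(−t,t)` and the onset kernels -/

/-- **Window form** (RH-free): for continuous `K₂` and any `K₁` with `|K₁(u)| ≤ K₂(u)` for `|u| < 2t`, window
operators `A₁`, `A₂` on `L²(−t,t)` with the kernel formulas `(A_iφ)(x) = ∫_{(−t,t)} K_i(x+y)φ(y) dy` satisfy
`‖A₁‖ ≤ ‖A₂‖`. -/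
theorem opNorm_winOp_le_of_abs_le {K₁ K₂ : ℝ → ℝ} (hK₂ : Continuous K₂) {t : ℝ}
    (hle : ∀ u : ℝ, |u| < 2 * t → |K₁ u| ≤ K₂ u)
    {A₁ A₂ : Lp ℝ 2 (volume.restrict (Ioo (-t) t)) →L[ℝ] Lp ℝ 2 (volume.restrict (Ioo (-t) t))}
    (hA₁ : ∀ φ, (A₁ φ : ℝ → ℝ) =ᵐ[volume.restrict (Ioo (-t) t)] fun x => ∫ y in Ioo (-t) t, K₁ (x + y) * φ y)
    (hA₂ : ∀ φ, (A₂ φ : ℝ → ℝ) =ᵐ[volume.restrict (Ioo (-t) t)] fun x => ∫ y in Ioo (-t) t, K₂ (x + y) * φ y) :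
    ‖A₁‖ ≤ ‖A₂‖ := by
  refine opNorm_le_of_abs_kernel_le (K₁ := fun x y => K₁ (x + y)) (K₂ := fun x y => K₂ (x + y))
    (memLp_winKernel hK₂ t) ?_ hA₁ hA₂
  filter_upwards [ae_restrict_mem measurableSet_Ioo] with x hx
  filter_upwards [ae_restrict_mem measurableSet_Ioo] with y hy
  exact hle (x + y) (abs_lt.mpr ⟨by linarith [hx.1, hy.1], by linarith [hx.2, hy.2]⟩)

/-- **`‖A_{θ+1}‖ ≤ 2‖A_θ‖` for the onset kernels** (RH-free; rh-dbr TARGET-v8 §L.4 (ii) `windowOp_succ_le_two_mul`):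
for `θ > 1` and window operators `A₁`, `A₂` on `L²(−1,1)` with kernels `(x+y)₊^θ` and `(x+y)₊^{θ−1}`,
`‖A₁‖ ≤ 2‖A₂‖` — since `(x+y)₊^θ = (x+y)₊ · (x+y)₊^{θ−1} ≤ 2(x+y)₊^{θ−1}` on `(−1,1)²`.  (`A_θ` is the operator of
the small-`t` law `σ₁(θ,t) ≈ c_θ‖A_θ‖t^θ` of the window norms, DATA §ET1f-lite; the law itself is not claimed.) -/
theorem opNorm_onsetOp_succ_le_two_mul {θ : ℝ} (hθ : 1 < θ)
    {A₁ A₂ : Lp ℝ 2 (volume.restrict (Ioo (-1 : ℝ) 1)) →L[ℝ] Lp ℝ 2 (volume.restrict (Ioo (-1 : ℝ) 1))}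
    (hA₁ : ∀ φ, (A₁ φ : ℝ → ℝ) =ᵐ[volume.restrict (Ioo (-1 : ℝ) 1)]
      fun x => ∫ y in Ioo (-1 : ℝ) 1, (max (x + y) 0) ^ θ * φ y)
    (hA₂ : ∀ φ, (A₂ φ : ℝ → ℝ) =ᵐ[volume.restrict (Ioo (-1 : ℝ) 1)]
      fun x => ∫ y in Ioo (-1 : ℝ) 1, (max (x + y) 0) ^ (θ - 1) * φ y) :
    ‖A₁‖ ≤ 2 * ‖A₂‖ := by
  have hθ1 : 0 ≤ θ - 1 := by linarith
  have hK₂ : Continuous fun u : ℝ => 2 * (max u 0) ^ (θ - 1) :=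
    continuous_const.mul ((continuous_id.max continuous_const).rpow_const fun _ => Or.inr hθ1)
  -- the operator `2 • A₂` has the kernel `2 (x+y)₊^{θ−1}`
  have hA₂' : ∀ φ, (((2 : ℝ) • A₂) φ : ℝ → ℝ) =ᵐ[volume.restrict (Ioo (-1 : ℝ) 1)]
      fun x => ∫ y in Ioo (-1 : ℝ) 1, 2 * (max (x + y) 0) ^ (θ - 1) * φ y := by
    intro φ
    rw [show ((2 : ℝ) • A₂) φ = (2 : ℝ) • A₂ φ from rfl]
    filter_upwards [Lp.coeFn_smul (2 : ℝ) (A₂ φ), hA₂ φ] with x hx hx2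
    rw [hx, Pi.smul_apply, hx2, smul_eq_mul, ← integral_const_mul]
    refine integral_congr_ae (Eventually.of_forall fun y => ?_)
    simp only; ring
  have h := opNorm_winOp_le_of_abs_le (K₁ := fun u => (max u 0) ^ θ) (t := 1) hK₂ ?_ hA₁ hA₂'
  · calc ‖A₁‖ ≤ ‖(2 : ℝ) • A₂‖ := h
      _ = 2 * ‖A₂‖ := by rw [norm_smul, Real.norm_two]
  · intro u hu
    have hm0 : 0 ≤ max u 0 := le_max_right _ _
    have hm2 : max u 0 ≤ 2 := max_le (by linarith [(abs_lt.mp hu).2]) (by norm_num)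
    show |max u 0 ^ θ| ≤ 2 * max u 0 ^ (θ - 1)
    rw [abs_of_nonneg (Real.rpow_nonneg hm0 θ), show θ = (θ - 1) + 1 by ring,
      Real.rpow_add_one' hm0 (by linarith), show θ - 1 + 1 - 1 = θ - 1 by ring]
    calc max u 0 ^ (θ - 1) * max u 0 ≤ max u 0 ^ (θ - 1) * 2 :=
          mul_le_mul_of_nonneg_left hm2 (Real.rpow_nonneg hm0 _)
      _ = 2 * max u 0 ^ (θ - 1) := mul_comm _ _

end Summit.RiemannHypothesis.RiemannHypothesis.Theorems.SuzukiWindowsDoorKernelMonotone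

end
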